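import Summits.CriticalPhenomena.PercolationContinuityZ3.Theorems.PercNearOneGluingNoHeavyQuantDECAtTarget
import Summits.CriticalPhenomena.PercolationContinuityZ3.Theorems.PercNearOneGluingNoHeavyQuantLawDecAbsorbPairs
import HarnessLib

/-!
# QUANT lane R8, T-DEC: the FLOW NORMAL FORM of DEC(j′), part 1 — `LawDec.DECAtT` yields an explicit transportation datum with gains
# (low atoms shipped to giants at rate `x/(1−x)` and to mids at their minimal credit gates); weak duality

builds on p205010 (kernel theorem, internal audit signed; external expert review pending)

Statement + support file (`--supports stmt-CriticalPhenomena-4575`), QUANT lane typer seat prim-quant-stmt (gen 22), rung R8 of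
`run/shared/lean/prim/quant/LADDER.md`.  Three small definitions (`LawDec.pairGate`, `LawDec.gateOf`, `LawDec.usage`), one `Prop`
(`LawDec.FlowAtT`), theorems with standard axioms, no sorries.  Continues `…QuantDECAtTarget` (typer g19: `DECAtT`, explicit target) and
prim-quant-census-2 g52's `…QuantLawDecAbsorbPairs` (`validAt_creditPair`, criterion D = the sufficiency half on `{0..j′}`).

WHY.  Every kernel use of a DEC HYPOTHESIS so far keeps the decomposition opaque (`tail_ge_of_decAt`, `decAt_shift`, `decAt_mono_floor`,
`decAtT_antitone_target`, `decAtT_mixture`), while every closure argument the census has found for Conjecture SL / `SDECConvClosed`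
(DEC-TAMP-G50 §3.4 (‡), DEC-CLOSURE-G53 §3: "two-row LP", re-routing of flows, certificate splitting) reads and rewrites a DEC datum as a
FLOW.  This file puts that normal form in the kernel once, so that a proof of SL can consume `DECAt` hypotheses as flows and produce flows.

THE NORMAL FORM (floor `0 < x < 1`, target `T`, layer `j′`, law `μ` on `{0..M}`).  LOW atoms: `l ≤ j′` with `2l < T` (rule (S) fails);
every other atom is self-sufficient.  A low atom can only be the `lo` of a pair `{l, h; g}`: a GIANT pair (`h ≥ j′+1`, `g ≥ x`) or a CREDIT
pair into a mid (`h ≤ j′`, `T < l + h`, `g ≥ γ(l,h) := max(ρ, x² + (1−x)ρ)`, `ρ = (T − 2l)/(h − l)` — `LawDec.validAt_creditPair`); shipping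
one unit of `l`-mass through a pair at gate `g` consumes `g/(1−g)` units of `h`-mass, minimal at the minimal gate.  Hence
* `LawDec.pairGate x T l h` = `γ(l,h)`; `LawDec.gateOf x T j′ l h` = `x` on giants, `γ(l,h)` on mids; `LawDec.usage` = `gateOf/(1 − gateOf)`.
* **`LawDec.FlowAtT x T j′ M μ`**: there are flows `f l h ≥ 0`, supported on (low `l`, compatible absorber `h ≤ M`: `h ≥ j′+1` or `T < l + h`),
  shipping every low atom exactly (`Σ_h f l h = μ l`) and overloading no absorber (`Σ_l usage·f l h ≤ μ h` for every non-low `h ≤ M`).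
* **`LawDec.flowAtT_of_decAtT`** (necessity, `0 < x < 1`): read the flows off any valid decomposition (`f l h = Σ_{lo r = l < hi r = h} λ_r(1 − g_r)`;
  a low atom is never a `hi` or a point; rule (N) forces `g ≥ γ`, rule (G) forces `g ≥ x`, and `t ↦ t/(1−t)` is monotone).
* (part 2, `…QuantLawDecFlowsDecomposition`: `LawDec.decAtT_of_flowAtT` — sufficiency, pairs at their minimal gates with weights `f/(1−γ)`,
  leftover absorber mass and all other self-sufficient mass as points; `decAtT_iff_flowAtT`, `decAt_iff_flowAt`.)
* **`LawDec.dual_le_of_decAtT`** (weak duality, the usable half of (‡)): for `β ≥ 0` on absorbers and `α_l ≤ usage(l,h)·β_h` on compatible pairs,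
  `Σ_{low} α_l μ l ≤ Σ_{non-low h ≤ M} β_h μ h`.

[this work]; DEC rules ARCH-TREES-G49 §2.2 / DEC-TAMP-G50 §3.1, §3.4 (‡); DEC-CLOSURE-G53 §3 (this lane).  LP duality for generalized flows is
classical (transportation problems with gains); nothing here is cited as a published result.  The gluing rows served
[cite: KozmaNitzan2024, Conjecture 3 (p. 15)]; product measure [cite: Grimmett1999, §1.3 p. 10].
-/

noncomputable section

namespace Summit.CriticalPhenomena.PercolationContinuityZ3.Theorems

namespace Quant

open Finset

/-- the two-point law `{lo, hi; g}` (as in `…QuantLawDEC`) -/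
local notation3 "TP[" lo ", " hi ", " g ", " h "]" =>
  (g : ℝ) * (if (h : ℕ) = (hi : ℕ) then (1 : ℝ) else 0) + (1 - (g : ℝ)) * (if (h : ℕ) = (lo : ℕ) then (1 : ℝ) else 0)

namespace LawDec

/-! ### Minimal gates and usage rates -/

/-- **minimal credit gate** of the pair `{l, h}` (`h` a mid) at target `T`, floor `x`: `γ = max(ρ, x² + (1−x)ρ)`, `ρ = (T − 2l)/(h − l)`
(`LawDec.validAt_creditPair`). [this work] -/
def pairGate (x T : ℝ) (l h : ℕ) : ℝ :=
  max ((T - 2 * (l : ℝ)) / ((h : ℝ) - l)) (x ^ 2 + (1 - x) * ((T - 2 * (l : ℝ)) / ((h : ℝ) - l)))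

/-- **the gate at which a low atom `l` is shipped to the absorber `h`**: `x` for a giant `h ≥ j′+1`, the minimal credit gate for a mid. [this work] -/
def gateOf (x T : ℝ) (j' l h : ℕ) : ℝ :=
  if j' + 1 ≤ h then x else pairGate x T l h

/-- **usage**: absorber mass consumed per unit of low mass shipped through `{l, h; gateOf}`, `= gateOf/(1 − gateOf)`. [this work] -/
def usage (x T : ℝ) (j' l h : ℕ) : ℝ :=
  gateOf x T j' l h / (1 - gateOf x T j' l h)

/-- **THE FLOW FORM OF DEC(j′) AT TARGET `T`** (law `μ` on `{0..M}`, floor `x`): flows `f l h ≥ 0` from LOW atoms (`l ≤ j′`, `2l < T`) to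
compatible ABSORBERS `h ≤ M` (`h ≥ j′+1`, or a mid with `T < l + h`) shipping every low atom exactly and loading every non-low atom `h ≤ M`
by at most its mass at the rates `LawDec.usage`. [this work] -/
def FlowAtT (x T : ℝ) (j' M : ℕ) (μ : ℕ → ℝ) : Prop :=
  ∃ f : ℕ → ℕ → ℝ,
    (∀ l h, 0 ≤ f l h) ∧
    (∀ l h, 0 < f l h → l ≤ j' ∧ 2 * (l : ℝ) < T ∧ h ≤ M ∧ (j' + 1 ≤ h ∨ T < (l : ℝ) + h)) ∧
    (∀ l, l ≤ j' → 2 * (l : ℝ) < T → ∑ h ∈ Finset.range (M + 1), f l h = μ l) ∧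
    (∀ h, h ≤ M → (j' + 1 ≤ h ∨ T ≤ 2 * (h : ℝ)) → ∑ l ∈ Finset.range (j' + 1), usage x T j' l h * f l h ≤ μ h)

/-! ### Elementary facts about the rates -/

/-- **rule (N) forces the gate above the minimal credit gate**: `lo < hi`, `T ≤ 2lo + (hi − lo)·κ_x(g)`, `0 < x < 1`, `g ≤ 1`
⟹ `pairGate x T lo hi ≤ g`. [this work] -/
theorem pairGate_le_of_credit (x T g : ℝ) (lo hi : ℕ) (hlt : lo < hi) (hx0 : 0 < x) (hx1 : x < 1)
    (hcr : T ≤ 2 * (lo : ℝ) + ((hi : ℝ) - lo) * (if x ≤ g then g else (g - x ^ 2) / (1 - x))) :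
    pairGate x T lo hi ≤ g := by
  have hd : (0 : ℝ) < (hi : ℝ) - lo := by
    have : (lo : ℝ) < hi := by exact_mod_cast hlt
    linarith
  set ρ : ℝ := (T - 2 * (lo : ℝ)) / ((hi : ℝ) - lo) with hρ
  have hρκ : ρ ≤ (if x ≤ g then g else (g - x ^ 2) / (1 - x)) := by
    rw [hρ, div_le_iff₀ hd]; linarith
  show max ρ (x ^ 2 + (1 - x) * ρ) ≤ g
  split_ifs at hρκ with hxg
  · refine max_le hρκ ?_
    nlinarith
  · have h1x : 0 < 1 - x := by linarith
    rw [le_div_iff₀ h1x] at hρκ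
    have hρx : ρ ≤ x := by nlinarith [not_le.1 hxg]
    refine max_le ?_ (by linarith)
    nlinarith [not_le.1 hxg]

/-- `pairGate ≥ ρ > 0`-type bound: `2l < T`, `l < h` ⟹ `0 < pairGate x T l h`. [this work] -/
theorem pairGate_pos (x T : ℝ) (l h : ℕ) (hlow : 2 * (l : ℝ) < T) (hlt : l < h) : 0 < pairGate x T l h := by
  have hd : (0 : ℝ) < (h : ℝ) - l := by
    have : (l : ℝ) < h := by exact_mod_cast hlt
    linarith
  exact lt_of_lt_of_le (div_pos (by linarith) hd) (le_max_left _ _)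

/-- a compatible credit pair has minimal gate `< 1`: `2l < T < l + h`, `0 < x < 1` ⟹ `pairGate x T l h < 1`. [this work] -/
theorem pairGate_lt_one (x T : ℝ) (l h : ℕ) (hx0 : 0 < x) (hx1 : x < 1) (hlow : 2 * (l : ℝ) < T) (hcomp : T < (l : ℝ) + h) :
    pairGate x T l h < 1 := by
  have hlt : (l : ℝ) < h := by linarith
  have hd : (0 : ℝ) < (h : ℝ) - l := by linarith
  have hρ1 : (T - 2 * (l : ℝ)) / ((h : ℝ) - l) < 1 := by rw [div_lt_one hd]; linarith
  refine max_lt hρ1 ?_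
  nlinarith

/-! ### Necessity: a valid decomposition yields flows -/

/-- **DEC(j′) AT TARGET `T` ⟹ THE FLOW FORM** (`0 < x < 1`).  See the file header. [this work] -/
theorem flowAtT_of_decAtT (x T : ℝ) (j' M : ℕ) (μ : ℕ → ℝ) (hx0 : 0 < x) (hx1 : x < 1)
    (h : DECAtT x T j' M μ) : FlowAtT x T j' M μ := by
  classical
  obtain ⟨ρ, hρ, lam, g, lo, hi, h0, h1, hg, hlohi, hhi, hμ, hval⟩ := h
  -- a low atom is neither a point nor a `hi`
  have key : ∀ r, 0 < lam r → ∀ l : ℕ, l ≤ j' → 2 * (l : ℝ) < T → l = hi r → False := by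
    intro r hr l hlj hlow hlhi
    rcases hval r hr with ⟨heq, hS⟩ | ⟨hlt, hgi, hxg⟩ | ⟨hlt, hhij, hcr⟩
    · rcases hS with h2 | h2
      · rw [heq, ← hlhi] at h2; linarith
      · rw [heq, ← hlhi] at h2; omega
    · omega
    · have hκ : (if x ≤ g r then g r else (g r - x ^ 2) / (1 - x)) ≤ 1 := by
        split_ifs with hxg
        · exact (hg r).2
        · rw [div_le_one (by linarith)]; nlinarith [not_le.1 hxg]
      have hd : (0 : ℝ) ≤ (hi r : ℝ) - lo r := by
        have : (lo r : ℝ) ≤ hi r := by exact_mod_cast hlt.le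
        linarith
      have := mul_le_mul_of_nonneg_left hκ hd
      have hlo : (lo r : ℝ) < hi r := by exact_mod_cast hlt
      rw [← hlhi] at hcr this hlo
      linarith
  -- the flows
  refine ⟨fun l h => if l ≤ j' ∧ 2 * (l : ℝ) < T then
      ∑ r, (if lo r = l ∧ hi r = h ∧ lo r < hi r then lam r * (1 - g r) else 0) else 0, ?_, ?_, ?_, ?_⟩
  · -- nonnegativity
    intro l h
    dsimp only
    split_ifs
    · exact Finset.sum_nonneg fun r _ => by split_ifs <;> nlinarith [h0 r, (hg r).2]
    · exact le_rfl
  · -- support: low source, compatible absorber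
    intro l h hpos
    dsimp only at hpos
    by_cases hl : l ≤ j' ∧ 2 * (l : ℝ) < T
    · rw [if_pos hl] at hpos
      obtain ⟨r, _, hr⟩ : ∃ r ∈ (Finset.univ : Finset ρ),
          0 < (if lo r = l ∧ hi r = h ∧ lo r < hi r then lam r * (1 - g r) else 0) := by
        by_contra hne
        push Not at hne
        exact absurd (Finset.sum_nonpos hne) (not_le.2 hpos)
      have hc : lo r = l ∧ hi r = h ∧ lo r < hi r := by
        by_contra hc; rw [if_neg hc] at hr; exact lt_irrefl _ hr
      rw [if_pos hc] at hr
      have hlam : 0 < lam r := by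
        by_contra hle
        have : lam r = 0 := le_antisymm (not_lt.1 hle) (h0 r)
        rw [this, zero_mul] at hr; exact lt_irrefl _ hr
      have hg1 : g r < 1 := by
        by_contra hle
        have : g r = 1 := le_antisymm (hg r).2 (not_lt.1 hle)
        rw [this, sub_self, mul_zero] at hr; exact lt_irrefl _ hr
      refine ⟨hl.1, hl.2, hc.2.1 ▸ hhi r, ?_⟩
      rcases hval r hlam with ⟨heq, _⟩ | ⟨_, hgi, _⟩ | ⟨hlt, hhij, hcr⟩
      · exact absurd heq (ne_of_lt hc.2.2)
      · exact Or.inl (hc.2.1 ▸ hgi)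
      · right
        have hκ1 : (if x ≤ g r then g r else (g r - x ^ 2) / (1 - x)) < 1 := by
          split_ifs with hxg
          · exact hg1
          · rw [div_lt_one (by linarith)]; nlinarith [not_le.1 hxg]
        have hd : (0 : ℝ) < (hi r : ℝ) - lo r := by
          have : (lo r : ℝ) < hi r := by exact_mod_cast hlt
          linarith
        have := mul_lt_mul_of_pos_left hκ1 hd
        rw [← hc.1, ← hc.2.1]
        linarith
    · rw [if_neg hl] at hpos; exact absurd hpos (lt_irrefl _)
  · -- every low atom is shipped exactly
    intro l hlj hlow
    dsimp only
    simp only [if_pos (show l ≤ j' ∧ 2 * (l : ℝ) < T from ⟨hlj, hlow⟩)]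
    rw [Finset.sum_comm, hμ l]
    refine Finset.sum_congr rfl fun r _ => ?_
    -- Σ_h over the indicator picks `h = hi r`
    have e1 : ∑ h ∈ Finset.range (M + 1), (if lo r = l ∧ hi r = h ∧ lo r < hi r then lam r * (1 - g r) else 0)
        = if lo r = l ∧ lo r < hi r then lam r * (1 - g r) else 0 := by
      rw [Finset.sum_eq_single (hi r)]
      · by_cases hc : lo r = l ∧ lo r < hi r
        · rw [if_pos ⟨hc.1, rfl, hc.2⟩, if_pos hc]
        · rw [if_neg hc, if_neg (fun h' => hc ⟨h'.1, h'.2.2⟩)]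
      · intro h _ hne; rw [if_neg (fun h' => hne h'.2.1.symm)]
      · intro hn; exact absurd (Finset.mem_range.2 (Nat.lt_succ_of_le (hhi r))) hn
    rw [e1]
    rcases (h0 r).eq_or_lt with hz | hpos
    · rw [← hz]; simp
    · have hne : l ≠ hi r := fun h' => key r hpos l hlj hlow h'
      rw [if_neg hne, mul_zero, zero_add]
      by_cases hlo : l = lo r
      · have hlt : lo r < hi r := lt_of_le_of_ne (hlohi r) (fun h' => hne (hlo.trans h'))
        rw [if_pos hlo, if_pos ⟨hlo.symm, hlt⟩, mul_one]
      · rw [if_neg hlo, if_neg (fun h' => hlo h'.1.symm), mul_zero, mul_zero]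
  · -- no absorber is overloaded
    intro h hhM hnl
    dsimp only
    -- rewrite the load as a sum over components
    have e1 : ∑ l ∈ Finset.range (j' + 1), usage x T j' l h *
        (if l ≤ j' ∧ 2 * (l : ℝ) < T then
          ∑ r, (if lo r = l ∧ hi r = h ∧ lo r < hi r then lam r * (1 - g r) else 0) else 0)
        = ∑ r, (if 2 * (lo r : ℝ) < T ∧ hi r = h ∧ lo r < hi r ∧ lo r ≤ j' then
            usage x T j' (lo r) h * (lam r * (1 - g r)) else 0) := by
      have e2 : ∀ l ∈ Finset.range (j' + 1), usage x T j' l h *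
          (if l ≤ j' ∧ 2 * (l : ℝ) < T then
            ∑ r, (if lo r = l ∧ hi r = h ∧ lo r < hi r then lam r * (1 - g r) else 0) else 0)
          = ∑ r, (if lo r = l ∧ 2 * (l : ℝ) < T ∧ hi r = h ∧ lo r < hi r then
              usage x T j' l h * (lam r * (1 - g r)) else 0) := by
        intro l hl
        have hlj : l ≤ j' := Nat.lt_succ_iff.1 (Finset.mem_range.1 hl)
        by_cases hlow : 2 * (l : ℝ) < T
        · rw [if_pos ⟨hlj, hlow⟩, Finset.mul_sum]
          refine Finset.sum_congr rfl fun r _ => ?_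
          by_cases hc : lo r = l ∧ hi r = h ∧ lo r < hi r
          · rw [if_pos hc, if_pos ⟨hc.1, hlow, hc.2.1, hc.2.2⟩]
          · rw [if_neg hc, if_neg (fun h' => hc ⟨h'.1, h'.2.2.1, h'.2.2.2⟩), mul_zero]
        · rw [if_neg (fun h' => hlow h'.2), mul_zero]
          symm
          exact Finset.sum_eq_zero fun r _ => if_neg (fun h' => hlow h'.2.1)
      rw [Finset.sum_congr rfl e2, Finset.sum_comm]
      refine Finset.sum_congr rfl fun r _ => ?_
      by_cases hc : 2 * (lo r : ℝ) < T ∧ hi r = h ∧ lo r < hi r ∧ lo r ≤ j'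
      · rw [if_pos hc, Finset.sum_eq_single (lo r)]
        · rw [if_pos ⟨rfl, hc.1, hc.2.1, hc.2.2.1⟩]
        · intro l _ hne; rw [if_neg (fun h' => hne h'.1.symm)]
        · intro hn; exact absurd (Finset.mem_range.2 (Nat.lt_succ_of_le hc.2.2.2)) hn
      · rw [if_neg hc]
        refine Finset.sum_eq_zero fun l hl => ?_
        have hlj : l ≤ j' := Nat.lt_succ_iff.1 (Finset.mem_range.1 hl)
        rw [if_neg]
        rintro ⟨h1', h2', h3', h4'⟩
        exact hc ⟨h1' ▸ h2', h3', h4', h1' ▸ hlj⟩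
    rw [e1, hμ h]
    refine Finset.sum_le_sum fun r _ => ?_
    rcases (h0 r).eq_or_lt with hz | hlam
    · -- zero weight: both sides vanish
      rw [← hz]; simp
    by_cases hc : 2 * (lo r : ℝ) < T ∧ hi r = h ∧ lo r < hi r ∧ lo r ≤ j'
    · rw [if_pos hc]
      have hrest : 0 ≤ lam r * ((1 - g r) * (if h = lo r then (1 : ℝ) else 0)) :=
        mul_nonneg (h0 r) (mul_nonneg (by linarith [(hg r).2]) (by split_ifs <;> norm_num))
      -- it suffices: usage·(1−g) ≤ g
      suffices hsuf : usage x T j' (lo r) h * (1 - g r) ≤ g r by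
        have := mul_le_mul_of_nonneg_left hsuf (h0 r)
        rw [← hc.2.1] at this hrest ⊢
        rw [if_pos rfl]
        nlinarith [hrest, this, h0 r, (hg r).1, (hg r).2]
      rcases (hg r).2.eq_or_lt with hg1 | hg1
      · rw [hg1, sub_self, mul_zero]; exact zero_le_one
      · -- the gate bound from validity
        have hgate : gateOf x T j' (lo r) h ≤ g r := by
          rcases hval r hlam with ⟨heq, _⟩ | ⟨hlt, hgi, hxg⟩ | ⟨hlt, hhij, hcr⟩
          · exact absurd heq (ne_of_lt hc.2.2.1)
          · simp only [gateOf, if_pos (hc.2.1 ▸ hgi)]; exact hxg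
          · have hnot : ¬ (j' + 1 ≤ h) := by rw [← hc.2.1]; omega
            simp only [gateOf, if_neg hnot]
            rw [← hc.2.1]
            exact pairGate_le_of_credit x T (g r) (lo r) (hi r) hlt hx0 hx1 hcr
        have hu : usage x T j' (lo r) h ≤ g r / (1 - g r) := by
          simp only [usage]
          rw [div_le_div_iff₀ (by linarith) (by linarith)]
          nlinarith
        have h1g : 0 < 1 - g r := by linarith
        calc usage x T j' (lo r) h * (1 - g r) ≤ g r / (1 - g r) * (1 - g r) :=
              mul_le_mul_of_nonneg_right hu h1g.le
          _ = g r := div_mul_cancel₀ _ h1g.ne'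
    · rw [if_neg hc]
      exact mul_nonneg (h0 r) (by
        refine add_nonneg (mul_nonneg (hg r).1 (by split_ifs <;> norm_num))
          (mul_nonneg (by linarith [(hg r).2]) (by split_ifs <;> norm_num)))

/-! ### Weak duality -/

/-- **WEAK DUALITY (the usable half of DEC-TAMP-G50 §3.4 (‡)).**  If `μ` is DEC(j′) at target `T` (floor `0 < x < 1`) then for every
price system — `β ≥ 0` on the atoms, `α_l ≤ usage(l,h)·β_h` for every low `l ≤ j′` and every compatible absorber `h ≤ M` — the low atoms
cannot be worth more than the absorbers: `Σ_{low l ≤ j′} α_l μ l ≤ Σ_{non-low h ≤ M} β_h μ h`. [this work] -/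
theorem dual_le_of_decAtT (x T : ℝ) (j' M : ℕ) (μ : ℕ → ℝ) (hx0 : 0 < x) (hx1 : x < 1)
    (h : DECAtT x T j' M μ) (α β : ℕ → ℝ) (hβ : ∀ h, 0 ≤ β h)
    (hαβ : ∀ l h, l ≤ j' → 2 * (l : ℝ) < T → h ≤ M → (j' + 1 ≤ h ∨ T < (l : ℝ) + h) →
      α l ≤ usage x T j' l h * β h) :
    ∑ l ∈ Finset.range (j' + 1), (if 2 * (l : ℝ) < T then α l * μ l else 0)
      ≤ ∑ h ∈ Finset.range (M + 1), (if h ≤ j' ∧ 2 * (h : ℝ) < T then 0 else β h * μ h) := by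
  classical
  obtain ⟨f, hf0, hsupp, hlow, hcap⟩ := flowAtT_of_decAtT x T j' M μ hx0 hx1 h
  have hf_zero : ∀ l h, ¬ (l ≤ j' ∧ 2 * (l : ℝ) < T ∧ h ≤ M ∧ (j' + 1 ≤ h ∨ T < (l : ℝ) + h)) → f l h = 0 := by
    intro l h hn
    by_contra hne
    exact hn (hsupp l h (lt_of_le_of_ne (hf0 l h) (Ne.symm hne)))
  -- low side: Σ α_l μ_l = Σ_l Σ_h α_l f l h ≤ Σ_l Σ_h usage β_h f l h
  calc ∑ l ∈ Finset.range (j' + 1), (if 2 * (l : ℝ) < T then α l * μ l else 0)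
      = ∑ l ∈ Finset.range (j' + 1), ∑ h ∈ Finset.range (M + 1), α l * f l h := by
        refine Finset.sum_congr rfl fun l hl => ?_
        have hlj : l ≤ j' := Nat.lt_succ_iff.1 (Finset.mem_range.1 hl)
        by_cases hl2 : 2 * (l : ℝ) < T
        · rw [if_pos hl2, ← Finset.mul_sum, hlow l hlj hl2]
        · rw [if_neg hl2]
          symm
          exact Finset.sum_eq_zero fun h _ => by rw [hf_zero l h (fun hc => hl2 hc.2.1), mul_zero]
    _ ≤ ∑ l ∈ Finset.range (j' + 1), ∑ h ∈ Finset.range (M + 1), (usage x T j' l h * β h) * f l h := by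
        refine Finset.sum_le_sum fun l hl => Finset.sum_le_sum fun h hh => ?_
        rcases (hf0 l h).eq_or_lt with hz | hp
        · rw [← hz, mul_zero, mul_zero]
        · obtain ⟨hlj, hl2, hhM, hc⟩ := hsupp l h hp
          exact mul_le_mul_of_nonneg_right (hαβ l h hlj hl2 hhM hc) hp.le
    _ = ∑ h ∈ Finset.range (M + 1), β h * ∑ l ∈ Finset.range (j' + 1), usage x T j' l h * f l h := by
        rw [Finset.sum_comm]
        refine Finset.sum_congr rfl fun h _ => ?_
        rw [Finset.mul_sum]
        refine Finset.sum_congr rfl fun l _ => ?_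
        ring
    _ ≤ ∑ h ∈ Finset.range (M + 1), (if h ≤ j' ∧ 2 * (h : ℝ) < T then 0 else β h * μ h) := by
        refine Finset.sum_le_sum fun h hh => ?_
        have hhM : h ≤ M := Nat.lt_succ_iff.1 (Finset.mem_range.1 hh)
        by_cases hl : h ≤ j' ∧ 2 * (h : ℝ) < T
        · rw [if_pos hl]
          have : ∑ l ∈ Finset.range (j' + 1), usage x T j' l h * f l h = 0 :=
            Finset.sum_eq_zero fun l _ => by
              rw [hf_zero l h ?_, mul_zero]
              rintro ⟨_, hl2, _, hc⟩
              rcases hc with hc | hc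
              · omega
              · linarith [hl.2]
          rw [this, mul_zero]
        · rw [if_neg hl]
          refine mul_le_mul_of_nonneg_left (hcap h hhM ?_) (hβ h)
          by_cases hj : j' + 1 ≤ h
          · exact Or.inl hj
          · exact Or.inr (not_lt.1 fun hlt => hl ⟨by omega, hlt⟩)


end LawDec

end Quant

end Summit.CriticalPhenomena.PercolationContinuityZ3.Theorems
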